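import Literature.MathematicalPhysics.KineticTheory.HardSphereBBGKYLiouvilleEstimate
import HarnessLib

/-!
# A Lipschitz-in-time version of the marginal along the tagged flow

Fifth file of the proof of `Literature.MathematicalPhysics.KineticTheory.bbgky_hierarchy_of_liouville`
(**hilbert6.S07**; plan in `HardSphereBBGKYLiouvilleFlow`). From the integrated Lipschitz estimate
of `HardSphereBBGKYLiouvilleEstimate` — `|∫_B (u(t₂) - u(t₁))| ≤ L (t₂ - t₁) ∫_B e^{-βE/2}` for the
honest `s`-marginal read along the tagged flow, `u(t, Y) = f_N^{(s)}(t)(Φs_t Y)` — we extract a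
*version* `ũ` of `u` which is, for **every** tagged datum `Y`, `L e^{-βE(Y)/2}`-Lipschitz in time,
measurable in `Y` at each time, and equal to `u(t, ·)` almost everywhere on `good_s` at each time
(`exists_lipschitz_marginal_flow`):

* the set-integral inequality gives the pointwise one a.e. for each pair of times
  (`ae_le_of_forall_setIntegral_le`), hence a.e. simultaneously for all pairs of dyadic times;
* on the resulting conull measurable set `G` the dyadic restriction of `u(·, Y)` is Lipschitz,
  and `ũ(t, Y)` is its limit along the lower dyadic approximations `⌊2^n t⌋/2^n` of `t`
  (Cauchy by the Lipschitz bound; `0` off `G`), a pointwise limit of measurable functions;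
* for each fixed `t` the pairs `(t, ⌊2^n t⌋/2^n)` show `u(⌊2^n t⌋/2^n, Y) → u(t, Y)` a.e., so
  `ũ(t, ·) = u(t, ·)` a.e.

This is the time-regularity "`P^{(s)}(T_t z^s, t)` is absolutely continuous in `t` for almost
all `z^s`" underlying CIP 1994 Thm 4.3.1 (mild form), obtained here from the collision-window
estimate rather than from the special-flow representation.

Theorems only; no definition and no named fact is introduced.

## References

* C. Cercignani, R. Illner, M. Pulvirenti, *The Mathematical Theory of Dilute Gases*, Springer
  (1994), Thm 4.3.1 and App. 4.B.
* H. Spohn, *On the integrated form of the BBGKY hierarchy for hard spheres*,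
  arXiv:math-ph/0605068, Prop. 5.
-/

open MeasureTheory Set Filter Topology Metric
open scoped ENNReal

namespace Literature.MathematicalPhysics.KineticTheory

open Literature.Analysis.FluidPDE

noncomputable section

variable {d : Type*} [Fintype d]

section Torus

variable {ε β CW : ℝ} {s m : ℕ}

/-- The marginal read along the tagged flow is measurable at each time. [folklore] -/
theorem measurable_marginal_flow (Φs : HardSphereFlow (Torus.geometry d) ε s)
    (ΦN : HardSphereFlow (Torus.geometry d) ε (s + m)) {W : Config (s + m) d (UnitAddTorus d) → ℝ}
    (hW : Measurable W) (t : ℝ) :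
    Measurable fun Y => nthMarginal (s + m) s (ΦN.good.indicator fun z => W (ΦN.flow (-t) z)) (Φs.flow t Y) :=
  (measurable_nthMarginal _ _ (measurable_indicator_transport ΦN hW t)).comp (Φs.measurable_flow t)

/-- The marginal read along the tagged flow is integrable on the good set at each time. [folklore] -/
theorem integrable_marginal_flow (Φs : HardSphereFlow (Torus.geometry d) ε s)
    (ΦN : HardSphereFlow (Torus.geometry d) ε (s + m)) {W : Config (s + m) d (UnitAddTorus d) → ℝ}
    (hW : Measurable W) (hWi : Integrable W) (t : ℝ) :
    Integrable (fun Y => nthMarginal (s + m) s (ΦN.good.indicator fun z => W (ΦN.flow (-t) z)) (Φs.flow t Y))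
      (volume.restrict Φs.good) := by
  have hρi := integrable_indicator_transport ΦN hW hWi t
  have hfsi : Integrable (nthMarginal (s + m) s (ΦN.good.indicator fun z => W (ΦN.flow (-t) z))) :=
    integrable_nthMarginal (Nat.le_add_right s m) hρi
  have hfsm : Measurable (nthMarginal (s + m) s (ΦN.good.indicator fun z => W (ΦN.flow (-t) z))) :=
    measurable_nthMarginal _ _ (measurable_indicator_transport ΦN hW t)
  exact ((Φs.measurePreserving_restrict_good t).integrable_comp hfsm.aestronglyMeasurable).2
    (hfsi.mono_measure Measure.restrict_le_self)

/-- **From the integrated to the almost-everywhere Lipschitz estimate, one pair of times.** If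
`|∫_B (u(t₂) - u(t₁))| ≤ L (t₂ - t₁) ∫_B e^{-βE/2}` for all measurable `B ⊆ good_s` then
`|u(t₂, Y) - u(t₁, Y)| ≤ L (t₂ - t₁) e^{-βE(Y)/2}` for a.e. `Y ∈ good_s`
(`ae_le_of_forall_setIntegral_le`, applied to `±(u(t₂) - u(t₁))`). [folklore] -/
theorem ae_abs_marginal_flow_sub_le (hβ : 0 < β) (Φs : HardSphereFlow (Torus.geometry d) ε s)
    (ΦN : HardSphereFlow (Torus.geometry d) ε (s + m)) {W : Config (s + m) d (UnitAddTorus d) → ℝ}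
    (hW : Measurable W) (hWi : Integrable W) {L : ℝ}
    (hL : ∀ t₁ t₂ : ℝ, t₁ ≤ t₂ → ∀ B : Set (Config s d (UnitAddTorus d)), MeasurableSet B → B ⊆ Φs.good →
      |∫ Y in B, (nthMarginal (s + m) s (ΦN.good.indicator fun z => W (ΦN.flow (-t₂) z)) (Φs.flow t₂ Y) -
          nthMarginal (s + m) s (ΦN.good.indicator fun z => W (ΦN.flow (-t₁) z)) (Φs.flow t₁ Y))| ≤
        L * (t₂ - t₁) * ∫ Y in B, Real.exp (-(β / 2) * configEnergy Y))
    {t₁ t₂ : ℝ} (h12 : t₁ ≤ t₂) :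
    ∀ᵐ Y ∂(volume.restrict Φs.good),
      |nthMarginal (s + m) s (ΦN.good.indicator fun z => W (ΦN.flow (-t₂) z)) (Φs.flow t₂ Y) -
          nthMarginal (s + m) s (ΦN.good.indicator fun z => W (ΦN.flow (-t₁) z)) (Φs.flow t₁ Y)| ≤
        L * (t₂ - t₁) * Real.exp (-(β / 2) * configEnergy Y) := by
  have hf : Integrable (fun Y => nthMarginal (s + m) s (ΦN.good.indicator fun z => W (ΦN.flow (-t₂) z)) (Φs.flow t₂ Y) -
      nthMarginal (s + m) s (ΦN.good.indicator fun z => W (ΦN.flow (-t₁) z)) (Φs.flow t₁ Y))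
      (volume.restrict Φs.good) :=
    (integrable_marginal_flow Φs ΦN hW hWi t₂).sub (integrable_marginal_flow Φs ΦN hW hWi t₁)
  have hEi : Integrable (fun Y : Config s d (UnitAddTorus d) => Real.exp (-(β / 2) * configEnergy Y)) :=
    integrable_exp_neg_mul_configEnergy (by positivity)
  have hg : Integrable (fun Y => L * (t₂ - t₁) * Real.exp (-(β / 2) * configEnergy Y)) (volume.restrict Φs.good) :=
    (hEi.mono_measure Measure.restrict_le_self).const_mul _
  -- the set-integral inequality on subsets of the good set
  have hset : ∀ S : Set (Config s d (UnitAddTorus d)), MeasurableSet S →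
      |∫ Y in S, (nthMarginal (s + m) s (ΦN.good.indicator fun z => W (ΦN.flow (-t₂) z)) (Φs.flow t₂ Y) -
          nthMarginal (s + m) s (ΦN.good.indicator fun z => W (ΦN.flow (-t₁) z)) (Φs.flow t₁ Y))
          ∂(volume.restrict Φs.good)| ≤
        ∫ Y in S, L * (t₂ - t₁) * Real.exp (-(β / 2) * configEnergy Y) ∂(volume.restrict Φs.good) := by
    intro S hS
    rw [Measure.restrict_restrict hS, integral_const_mul]
    exact hL t₁ t₂ h12 (S ∩ Φs.good) (hS.inter Φs.measurableSet_good) inter_subset_right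
  have hup := ae_le_of_forall_setIntegral_le hf hg fun S hS _ => (le_abs_self _).trans (hset S hS)
  have hdown := ae_le_of_forall_setIntegral_le hf.neg hg fun S hS _ => by
    rw [integral_neg']
    exact (neg_le_abs _).trans (hset S hS)
  filter_upwards [hup, hdown] with Y h1 h2
  rw [abs_le]
  simp only [Pi.neg_apply] at h2
  constructor <;> linarith

/-- The lower dyadic approximation `⌊2^n t⌋ / 2^n` is within `2^{-n}` of `t`. [folklore] -/
theorem abs_sub_dyadFloor_le (n : ℕ) (t : ℝ) : |t - ((⌊t * 2 ^ n⌋ : ℤ) : ℝ) / 2 ^ n| ≤ 1 / 2 ^ n := by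
  have h2 : (0 : ℝ) < 2 ^ n := by positivity
  have hfl := Int.floor_le (t * 2 ^ n)
  have hlt := Int.lt_floor_add_one (t * 2 ^ n)
  have h1 : ((⌊t * 2 ^ n⌋ : ℤ) : ℝ) / 2 ^ n ≤ t := by rw [div_le_iff₀ h2]; exact hfl
  have h3 : t < (((⌊t * 2 ^ n⌋ : ℤ) : ℝ) + 1) / 2 ^ n := by rw [lt_div_iff₀ h2]; exact hlt
  rw [add_div] at h3
  have h4 : (0 : ℝ) < 1 / 2 ^ n := by positivity
  rw [abs_le]
  constructor <;> linarith

/-- The lower dyadic approximations converge. [folklore] -/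
theorem tendsto_dyadFloor (t : ℝ) : Tendsto (fun n : ℕ => ((⌊t * 2 ^ n⌋ : ℤ) : ℝ) / 2 ^ n) atTop (𝓝 t) := by
  have h0 : Tendsto (fun n : ℕ => (1 : ℝ) / 2 ^ n) atTop (𝓝 0) := by
    have h := tendsto_pow_atTop_nhds_zero_of_lt_one (r := (2⁻¹ : ℝ)) (by norm_num) (by norm_num)
    refine h.congr fun n => ?_
    rw [one_div, inv_pow]
  have h1 : Tendsto (fun n : ℕ => t - ((⌊t * 2 ^ n⌋ : ℤ) : ℝ) / 2 ^ n) atTop (𝓝 0) :=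
    squeeze_zero_norm (fun n => by rw [Real.norm_eq_abs]; exact abs_sub_dyadFloor_le n t) h0
  have h2 : Tendsto (fun n : ℕ => t - (t - ((⌊t * 2 ^ n⌋ : ℤ) : ℝ) / 2 ^ n)) atTop (𝓝 (t - 0)) :=
    tendsto_const_nhds.sub h1
  simpa using h2

/-- **A Lipschitz-in-time, measurable version of the marginal along the tagged flow.** On the flat
torus with `0 < ε ≤ 1/2`, for hard-sphere flows `Φs`, `ΦN` of `s` and `s + m` particles and a
measurable integrable `W` with `|W| ≤ C_W e^{-βE}` (`β > 0`), there are `L ≥ 0` and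
`ũ : ℝ → Config s → ℝ` with: `ũ(t, ·)` measurable for every `t`; `|ũ(t, Y) - ũ(t', Y)| ≤
L e^{-βE(Y)/2} |t - t'|` for **all** `Y, t, t'`; and for every `t`,
`ũ(t, Y) = f_N^{(s)}(t)(Φs_t Y)` for a.e. `Y ∈ good_s`, where `f_N(t) = 1_{good_N} W ∘ ΦN_{-t}`
and `f^{(s)} = nthMarginal (s+m) s` (the honest marginal of GST 2013 (4.3.2)). See the module
docstring for the construction (dyadic times, `ae_le_of_forall_setIntegral_le`, Cauchy limits).
This is the a.e. absolute continuity in time of `P^{(s)}(T_t z^s, t)` of CIP 1994 Thm 4.3.1. [cite: CIP1994, Thm 4.3.1] -/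
theorem exists_lipschitz_marginal_flow (hε : 0 < ε) (hε2 : ε ≤ 1 / 2) (hβ : 0 < β)
    (Φs : HardSphereFlow (Torus.geometry d) ε s) (ΦN : HardSphereFlow (Torus.geometry d) ε (s + m))
    {W : Config (s + m) d (UnitAddTorus d) → ℝ} (hW : Measurable W) (hWi : Integrable W)
    (hCW : 0 ≤ CW) (hWb : ∀ z, |W z| ≤ CW * Real.exp (-β * configEnergy z)) :
    ∃ (L : ℝ) (ut : ℝ → Config s d (UnitAddTorus d) → ℝ), 0 ≤ L ∧
      (∀ t, Measurable (ut t)) ∧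
      (∀ Y t t', |ut t Y - ut t' Y| ≤ L * Real.exp (-(β / 2) * configEnergy Y) * |t - t'|) ∧
      (∀ t, ∀ᵐ Y ∂(volume.restrict Φs.good),
        ut t Y = nthMarginal (s + m) s (ΦN.good.indicator fun z => W (ΦN.flow (-t) z)) (Φs.flow t Y)) := by
  classical
  obtain ⟨L, hL0, hL⟩ := abs_setIntegral_marginal_flow_sub_le hε hε2 hβ Φs ΦN hW hWi hCW hWb
  -- the marginal along the flow, as an opaque function, and the Lipschitz weight
  obtain ⟨u, hu⟩ : ∃ u : ℝ → Config s d (UnitAddTorus d) → ℝ, u = fun t Y =>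
      nthMarginal (s + m) s (ΦN.good.indicator fun z => W (ΦN.flow (-t) z)) (Φs.flow t Y) := ⟨_, rfl⟩
  obtain ⟨e, he⟩ : ∃ e : Config s d (UnitAddTorus d) → ℝ, e = fun Y =>
      L * Real.exp (-(β / 2) * configEnergy Y) := ⟨_, rfl⟩
  have he0 : ∀ Y, 0 ≤ e Y := fun Y => by rw [he]; positivity
  have hum : ∀ t, Measurable (u t) := fun t => by rw [hu]; exact measurable_marginal_flow Φs ΦN hW t
  have hem : Measurable e := by rw [he]; unfold configEnergy; fun_prop
  -- a.e. Lipschitz for each pair of times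
  have hpair : ∀ t t' : ℝ, ∀ᵐ Y ∂(volume.restrict Φs.good), |u t Y - u t' Y| ≤ e Y * |t - t'| := by
    have hord : ∀ t₁ t₂ : ℝ, t₁ ≤ t₂ → ∀ᵐ Y ∂(volume.restrict Φs.good), |u t₂ Y - u t₁ Y| ≤ e Y * |t₂ - t₁| := by
      intro t₁ t₂ h12
      filter_upwards [ae_abs_marginal_flow_sub_le hβ Φs ΦN hW hWi hL h12] with Y hY
      rw [hu, he, abs_of_nonneg (sub_nonneg.2 h12)]
      calc _ ≤ L * (t₂ - t₁) * Real.exp (-(β / 2) * configEnergy Y) := hY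
        _ = _ := by ring
    intro t t'
    rcases le_total t t' with h | h
    · filter_upwards [hord t t' h] with Y hY
      rwa [abs_sub_comm, abs_sub_comm t t']
    · exact hord t' t h
  -- dyadic times `D p = p.2 / 2^{p.1}`
  obtain ⟨D, hD⟩ : ∃ D : ℕ × ℤ → ℝ, D = fun p => ((p.2 : ℤ) : ℝ) / 2 ^ p.1 := ⟨_, rfl⟩
  have hdy : ∀ᵐ Y ∂(volume.restrict Φs.good), ∀ p q : ℕ × ℤ, |u (D p) Y - u (D q) Y| ≤ e Y * |D p - D q| := by
    rw [ae_all_iff]; intro p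
    rw [ae_all_iff]; intro q
    exact hpair (D p) (D q)
  -- the good set
  obtain ⟨G, hG⟩ : ∃ G : Set (Config s d (UnitAddTorus d)), G = {Y | ∀ p q : ℕ × ℤ,
      |u (D p) Y - u (D q) Y| ≤ e Y * |D p - D q|} := ⟨_, rfl⟩
  have hGm : MeasurableSet G := by
    rw [hG]
    have : {Y : Config s d (UnitAddTorus d) | ∀ p q : ℕ × ℤ, |u (D p) Y - u (D q) Y| ≤ e Y * |D p - D q|} =
        ⋂ (p : ℕ × ℤ) (q : ℕ × ℤ), {Y | |u (D p) Y - u (D q) Y| ≤ e Y * |D p - D q|} := by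
      ext Y; simp only [mem_setOf_eq, mem_iInter]
    rw [this]
    refine MeasurableSet.iInter fun p => MeasurableSet.iInter fun q => ?_
    exact measurableSet_le (((hum _).sub (hum _)).abs) (hem.mul_const _)
  have hGae : ∀ᵐ Y ∂(volume.restrict Φs.good), Y ∈ G := by
    rw [hG]; exact hdy
  -- the approximating sequence and its limit
  obtain ⟨f, hf⟩ : ∃ f : ℝ → ℕ → Config s d (UnitAddTorus d) → ℝ, f = fun t n =>
      G.indicator (u (D (n, ⌊t * 2 ^ n⌋))) := ⟨_, rfl⟩
  have hfm : ∀ (t : ℝ) (n : ℕ), Measurable (f t n) := fun t n => by rw [hf]; exact (hum _).indicator hGm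
  have hDn : ∀ (t : ℝ) (n : ℕ), D (n, ⌊t * 2 ^ n⌋) = ((⌊t * 2 ^ n⌋ : ℤ) : ℝ) / 2 ^ n := fun t n => by rw [hD]
  have hDclose : ∀ (t : ℝ) (n : ℕ), |t - D (n, ⌊t * 2 ^ n⌋)| ≤ 1 / 2 ^ n := fun t n => by
    rw [hDn]; exact abs_sub_dyadFloor_le n t
  have hDlim : ∀ t : ℝ, Tendsto (fun n : ℕ => D (n, ⌊t * 2 ^ n⌋)) atTop (𝓝 t) := fun t => by
    simp only [hDn]; exact tendsto_dyadFloor t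
  have h0 : Tendsto (fun n : ℕ => (1 : ℝ) / 2 ^ n) atTop (𝓝 0) := by
    have h := tendsto_pow_atTop_nhds_zero_of_lt_one (r := (2⁻¹ : ℝ)) (by norm_num) (by norm_num)
    refine h.congr fun n => ?_
    rw [one_div, inv_pow]
  -- on `G` the sequence is Cauchy
  have hconv : ∀ (t : ℝ) (Y : Config s d (UnitAddTorus d)), ∃ x, Tendsto (fun n => f t n Y) atTop (𝓝 x) := by
    intro t Y
    by_cases hY : Y ∈ G
    · have hfY : ∀ n : ℕ, f t n Y = u (D (n, ⌊t * 2 ^ n⌋)) Y := fun n => by rw [hf]; exact indicator_of_mem hY _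
      simp only [hfY]
      refine cauchySeq_tendsto_of_complete (cauchySeq_of_le_tendsto_0 (fun N => e Y * (2 * (1 / 2 ^ N)))
        (fun n k N hn hk => ?_) ?_)
      · rw [Real.dist_eq]
        have hYG : ∀ p q : ℕ × ℤ, |u (D p) Y - u (D q) Y| ≤ e Y * |D p - D q| := by rw [hG] at hY; exact hY
        calc |u (D (n, ⌊t * 2 ^ n⌋)) Y - u (D (k, ⌊t * 2 ^ k⌋)) Y|
            ≤ e Y * |D (n, ⌊t * 2 ^ n⌋) - D (k, ⌊t * 2 ^ k⌋)| := hYG _ _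
          _ ≤ e Y * (1 / 2 ^ n + 1 / 2 ^ k) := by
              gcongr
              · exact he0 Y
              · calc |D (n, ⌊t * 2 ^ n⌋) - D (k, ⌊t * 2 ^ k⌋)|
                    = |(t - D (k, ⌊t * 2 ^ k⌋)) - (t - D (n, ⌊t * 2 ^ n⌋))| := by ring_nf
                  _ ≤ |t - D (k, ⌊t * 2 ^ k⌋)| + |t - D (n, ⌊t * 2 ^ n⌋)| := abs_sub _ _
                  _ ≤ 1 / 2 ^ k + 1 / 2 ^ n := add_le_add (hDclose t k) (hDclose t n)
                  _ = _ := add_comm _ _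
          _ ≤ e Y * (2 * (1 / 2 ^ N)) := by
              gcongr
              · exact he0 Y
              · have hn' : (1 : ℝ) / 2 ^ n ≤ 1 / 2 ^ N :=
                  one_div_le_one_div_of_le (by positivity) (pow_le_pow_right₀ (by norm_num) hn)
                have hk' : (1 : ℝ) / 2 ^ k ≤ 1 / 2 ^ N :=
                  one_div_le_one_div_of_le (by positivity) (pow_le_pow_right₀ (by norm_num) hk)
                linarith
      · have := h0.const_mul (e Y * 2)
        simp only [mul_zero] at this
        refine this.congr fun N => ?_
        ring
    · refine ⟨0, ?_⟩
      have hfY : ∀ n : ℕ, f t n Y = 0 := fun n => by rw [hf]; exact indicator_of_notMem hY _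
      simp only [hfY]
      exact tendsto_const_nhds
  -- the version
  obtain ⟨ut, hut⟩ : ∃ ut : ℝ → Config s d (UnitAddTorus d) → ℝ, ut = fun t Y =>
      limUnder atTop (fun n => f t n Y) := ⟨_, rfl⟩
  have hT : ∀ (t : ℝ) (Y : Config s d (UnitAddTorus d)), Tendsto (fun n => f t n Y) atTop (𝓝 (ut t Y)) := fun t Y => by
    rw [hut]; exact tendsto_nhds_limUnder (hconv t Y)
  have hut0 : ∀ (t : ℝ) (Y : Config s d (UnitAddTorus d)), Y ∉ G → ut t Y = 0 := fun t Y hY => by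
    have hfY : ∀ n : ℕ, f t n Y = 0 := fun n => by rw [hf]; exact indicator_of_notMem hY _
    have h1 : Tendsto (fun n => f t n Y) atTop (𝓝 0) := by simp only [hfY]; exact tendsto_const_nhds
    exact tendsto_nhds_unique (hT t Y) h1
  refine ⟨L, ut, hL0, ?_, ?_, ?_⟩
  · -- measurability
    intro t
    exact measurable_of_tendsto_metrizable (hfm t) (tendsto_pi_nhds.2 (hT t))
  · -- Lipschitz in time, for every `Y`
    intro Y t t'
    by_cases hY : Y ∈ G
    · have hYG : ∀ p q : ℕ × ℤ, |u (D p) Y - u (D q) Y| ≤ e Y * |D p - D q| := by rw [hG] at hY; exact hY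
      have hfY : ∀ (τ : ℝ) (n : ℕ), f τ n Y = u (D (n, ⌊τ * 2 ^ n⌋)) Y := fun τ n => by rw [hf]; exact indicator_of_mem hY _
      have hlim1 : Tendsto (fun n => |f t n Y - f t' n Y|) atTop (𝓝 |ut t Y - ut t' Y|) :=
        ((hT t Y).sub (hT t' Y)).abs
      have hlim2 : Tendsto (fun n => e Y * |D (n, ⌊t * 2 ^ n⌋) - D (n, ⌊t' * 2 ^ n⌋)|) atTop
          (𝓝 (e Y * |t - t'|)) :=
        (((hDlim t).sub (hDlim t')).abs).const_mul _
      have hle : ∀ n : ℕ, |f t n Y - f t' n Y| ≤ e Y * |D (n, ⌊t * 2 ^ n⌋) - D (n, ⌊t' * 2 ^ n⌋)| := by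
        intro n; rw [hfY, hfY]; exact hYG _ _
      have := le_of_tendsto_of_tendsto hlim1 hlim2 (Eventually.of_forall hle)
      rw [he] at this
      simpa [mul_assoc] using this
    · rw [hut0 t Y hY, hut0 t' Y hY, sub_self, abs_zero]
      positivity
  · -- agreement with the marginal a.e., at each time
    intro t
    have hn : ∀ᵐ Y ∂(volume.restrict Φs.good), ∀ n : ℕ, |u t Y - u (D (n, ⌊t * 2 ^ n⌋)) Y| ≤ e Y * (1 / 2 ^ n) := by
      rw [ae_all_iff]; intro n
      filter_upwards [hpair t (D (n, ⌊t * 2 ^ n⌋))] with Y hY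
      exact hY.trans (mul_le_mul_of_nonneg_left (hDclose t n) (he0 Y))
    filter_upwards [hGae, hn] with Y hYG hYn
    have hfY : ∀ n : ℕ, f t n Y = u (D (n, ⌊t * 2 ^ n⌋)) Y := fun n => by rw [hf]; exact indicator_of_mem hYG _
    -- `u (D_n t) Y → u t Y`
    have hconv' : Tendsto (fun n => f t n Y) atTop (𝓝 (u t Y)) := by
      simp only [hfY]
      rw [tendsto_iff_norm_sub_tendsto_zero]
      refine squeeze_zero_norm (fun n => ?_) ((h0.const_mul (e Y)).trans_eq (by simp))
      rw [norm_norm, Real.norm_eq_abs, abs_sub_comm]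
      exact hYn n
    rw [tendsto_nhds_unique (hT t Y) hconv', hu]

end Torus

end

end Literature.MathematicalPhysics.KineticTheory
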